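import Mathlib
import Literature.NumberTheory.LFunctions.WeilWindowSimpleEven
import Literature.NumberTheory.LFunctions.WeilExplicitProofs

/-!
# `SignCone.SignConeDuality`, line `Sketch` — stub `stub_slater` (the Slater bump)
(crux item stmt-RiemannHypothesis-16304, route route-RiemannHypothesis-SignCone)

The cone-multiplier engine of the duality step needs a SLATER POINT of the image cone: one Weil
test `g` supported in `[-a, a]` whose autocorrelation `G = g ⋆ g̃`,
`G(t) = ∫ g(u) conj (g (u - t)) du`, has `Re G(log n) > 0` at every node `log n < 2a`.
Take `g` = the smooth bump `ContDiffBump (0 : ℝ)` with radii `a/2 < a`, cast to `ℂ`: `g ≥ 0`,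
`g > 0` on `(-a, a)`, so `G(t) = ∫ g(s) g(s - t) ds > 0` for `0 ≤ t < 2a` (the integrand is
continuous, compactly supported, nonnegative, and positive at `s = t/2`).

Adapted from `Cruxes/SignConeDuality/SketchIdeator1.lean` (`autocorr_ofReal_apply`,
`slater_bump`), repackaged over the Literature vocabulary `IsWeilTest`, `weilConv`, `weilReflect`.
-/

noncomputable section

-- `Summit.RiemannHypothesis.RiemannHypothesis.…` repeats a namespace component by design (D-0017 layout).
set_option linter.dupNamespace false

open scoped BigOperators ComplexConjugate
open Complex MeasureTheory Set

namespace Summit.RiemannHypothesis.RiemannHypothesis.Theorems.SignConeDuality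

open Literature.NumberTheory.LFunctions

-- adapted from Cruxes/SignConeDuality/SketchIdeator1.lean (`autocorr_ofReal_apply`)
/-- Autocorrelation `ψ ⋆ ψ̃` of a REAL function `ψ` cast to `ℂ`, as a real integral:
`(ψ ⋆ ψ̃)(t) = ∫ ψ(s) ψ(s - t) ds`. -/
theorem weilConv_weilReflect_ofReal_apply (ψ : ℝ → ℝ) (t : ℝ) :
    weilConv (fun x => ((ψ x : ℝ) : ℂ)) (weilReflect fun x => ((ψ x : ℝ) : ℂ)) t =
      ((∫ s, ψ s * ψ (s - t) : ℝ) : ℂ) := by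
  rw [weilConv_apply, ← integral_complex_ofReal]
  congr 1
  funext s
  simp [weilReflect, neg_sub, Complex.ofReal_mul]

-- adapted from Cruxes/SignConeDuality/SketchIdeator1.lean (`slater_bump`)
/-- **Slater point.** For every cutoff `a > 0` there is ONE Weil test `g` (a nonnegative smooth
bump, radii `a/2 < a`, cast to `ℂ`) supported in `[-a, a]` whose autocorrelation `g ⋆ g̃` has
positive real part at every node `log n` with `2 ≤ n` and `log n < 2a`. -/
theorem stub_slater : ∀ a : ℝ, 0 < a →
    ∃ g : ℝ → ℂ, IsWeilTest g ∧ tsupport g ⊆ Set.Icc (-a) a ∧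
      ∀ n : ℕ, 2 ≤ n → Real.log n < 2 * a →
        0 < (weilConv g (weilReflect g) (Real.log n)).re := by
  intro a ha
  let φ : ContDiffBump (0 : ℝ) := ⟨a / 2, a, by positivity, by linarith⟩
  have hrOut : φ.rOut = a := rfl
  refine ⟨fun x => ((φ x : ℝ) : ℂ), ⟨?_, ?_⟩, ?_, fun n hn hlog => ?_⟩
  · exact Complex.ofRealCLM.contDiff.comp φ.contDiff
  · exact φ.hasCompactSupport.comp_left (g := fun r : ℝ => (r : ℂ)) Complex.ofReal_zero
  · have hs : Function.support (fun x => ((φ x : ℝ) : ℂ)) = Function.support (φ : ℝ → ℝ) := by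
      ext x; simp
    have ht : tsupport (fun x => ((φ x : ℝ) : ℂ)) = tsupport (φ : ℝ → ℝ) := by
      simp only [tsupport, hs]
    rw [ht, φ.tsupport_eq, hrOut, Real.closedBall_eq_Icc, zero_sub, zero_add]
  · set L := Real.log n with hL
    have hn1 : (1 : ℝ) < n := by exact_mod_cast (lt_of_lt_of_le one_lt_two hn)
    have hLpos : 0 < L := Real.log_pos hn1
    rw [weilConv_weilReflect_ofReal_apply (φ : ℝ → ℝ) L, Complex.ofReal_re]
    refine Continuous.integral_pos_of_hasCompactSupport_nonneg_nonzero (x := L / 2) ?_ ?_ ?_ ?_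
    · exact φ.continuous.mul (φ.continuous.comp (continuous_id.sub continuous_const))
    · exact φ.hasCompactSupport.mul_right
    · exact fun s => mul_nonneg φ.nonneg φ.nonneg
    · have h1 : 0 < φ (L / 2) := by
        refine φ.pos_of_mem_ball ?_
        rw [Metric.mem_ball, dist_zero_right, Real.norm_eq_abs, hrOut, abs_of_pos (by linarith)]
        linarith
      have h2 : 0 < φ (L / 2 - L) := by
        refine φ.pos_of_mem_ball ?_
        rw [Metric.mem_ball, dist_zero_right, Real.norm_eq_abs, hrOut,
          show L / 2 - L = -(L / 2) by ring, abs_neg, abs_of_pos (by linarith)]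
        linarith
      exact (mul_pos h1 h2).ne'

end Summit.RiemannHypothesis.RiemannHypothesis.Theorems.SignConeDuality

end
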